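import Literature.AlgebraicGeometry.Motives.HodgeLieWeilClassesProductCorner
import Summits.HodgeConjecture.CorCM.MumfordTateRankQuadraticFieldAction
import HarnessLib

/-!
# Two abelian varieties of Ribet type `(g−1,1)` of the same dimension with ISOMORPHIC fields: `t(A × A') ≤ 2g² < t(A) + t(A') − 1`;
# in particular two simple type-IV(2,1) threefolds: `10 ≤ t(T × T') ≤ 18 < 19`
# (`Hg(A × A') ≠ Hg(A) × Hg(A')`: the Weil classes of the diagonal `k`-action of signature `(g,g)` — Moonen–Zarhin's mechanism (4)(a) one factor up)

COR-CM (cell `pub-hodgecm2`, seat `b27` gen 48, count-neutral Mumford–Tate-rank ladder; theorems only, no definition, no named fact;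
UNCONDITIONAL — nothing here uses or asserts HC_CM).  `A`, `A'` of RIBET TYPE `(g−1,1)`: `End⁰ = ℚ(√−D)` imaginary quadratic (`dim_ℚ End⁰ = 2`,
`φ ∘ φ = −D`, `φ' ∘ φ' = −D` — the SAME `D`, i.e. isomorphic fields), multiplicity one at `± i√D`, `dim A = dim A' = g ≥ 3` (`t = g² + 1`,
`Lie Hg = 𝔲(g−1,1)`-form of dimension `g²`).  Matching the roots so that `n_{i√D}(A) + n_{i√D}(A') = g` (replace `φ'` by `−φ'` otherwise — always
possible since both multiplicities lie in `{1, g−1}`), the diagonal action of `k` on `H¹(A × A')` is OF WEIL TYPE (`2·g = 4g/2`), its Weil classes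
`⋀^{2g}_k H¹(A × A') ⊂ H^{2g}` are Hodge classes moved by the corner `0 ⊕ φ'^*` (`Motives/HodgeLieWeilClassesProductCorner`), and
`φ'^* ∈ Lie Hg(H¹A') = 𝔲_k(H¹A', ψ)` (`UnitaryTheta.mem_hodgeLie_iff_commute_and_skew`, `φ'` is `ψ`-skew by
`UnitaryTheta.form_apply_add_form_apply_eq_zero`).  Hence **`dim Lie Hg(H¹(A × A')) < g² + g²`**, i.e. **`g² + 1 ≤ t(A × A') ≤ 2g² < 2g² + 1 =
t(A) + t(A') − 1`**: the Hodge group of the product is NEVER the product of the Hodge groups (for `A ∼ A'` of course `t = g² + 1`).  Simple abelian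
threefolds with `dim_ℚ End⁰ = 2` are of Ribet type `(2,1)` (Shimura), whence the threefold cell `10 ≤ t(T × T') ≤ 18`.

* §1 `bettiMap_mem_hodgeLie_of_ribetTypeOne` — `φ^* ∈ Lie Hg(H¹A)` for Ribet type; threefold specialisations; `exists_matched_data_of_ringHom_threefolds`
  — matched `φ, φ', D` from a ring hom `End⁰T' → End⁰T`.
* §2 **`finrank_hodgeLie_hodge_one_prod_ribetTypeOne_lt`** (`dim Lie Hg(H¹(A × A')) < 2g²`, matched roots),
  **`mtRank_hodge_one_le_of_isIsogenous_prod_ribetTypeOne_of_comp_self_eq_neg`** (`t(X) ≤ 2g²` for `X ∼ A × A'`, any `φ'` with `φ' ∘ φ' = −D`).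
* the threefold cells (`dim Lie Hg(H¹(T × T')) ≤ 17`, `10 ≤ t(T × T') ≤ 18`) are in the sequel `CorCM/MumfordTateRankTypeIVThreefoldPairsCells`
  (size limit).

## References
* [MoonenZarhin1999LowDim] B. Moonen, Yu. G. Zarhin, Math. Ann. 315 (1999), Thm. 0.1 (4)(a), §2 (2.3), §3 (3.1), Prop. (3.8)
  [corpus: paper:arxiv-math_9901113 pp. 1–2, 5–7]. [cite: MoonenZarhin1999LowDim, Thm. 0.1 (4) and §3 (3.1)]
* [Deligne1982HodgeCycles] P. Deligne, LNM 900 (1982), §4 Prop. 4.4 (Weil classes). [cite: Deligne1982HodgeCycles, §4 Prop. 4.4]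
* [Ribet1983] K. A. Ribet, Amer. J. Math. 105 (1983), Thm. 3 (`Hg = U` for type `(g−1,1)`). [cite: Ribet1983, Thm. 3]
* [MumfordAV1970] D. Mumford, *Abelian Varieties* (1970), §19 Thm. 3 and Cor. 2, §21. [cite: MumfordAV1970, §19 Thm. 3 and Cor. 2]
* [LangeBirkenhake1992] H. Lange, Ch. Birkenhake, *Complex Abelian Varieties* (1992), §1.1. [cite: LangeBirkenhake1992, §1.1 (p. 19)]
-/

noncomputable section

open scoped TensorProduct
open CategoryTheory CategoryTheory.Limits Module NumberField

namespace Summit.HodgeConjecture.CorCM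

open Literature.AlgebraicGeometry.Motives
open Literature.AlgebraicGeometry.Motives.AbelianVariety
open Literature.AlgebraicGeometry.Motives.HodgeStructure
open Literature.AlgebraicGeometry.HodgeTheory
open Literature.AlgebraicGeometry.ComplexMultiplication

/-! ## §1 `φ^* ∈ Lie Hg(H¹A)` for Ribet type; matched data for two threefolds -/

section RibetType

variable [HodgeTensorFacts.{0, 0}] {A : AbelianVariety ℂ} {n : ℕ}

/-- **`φ^* ∈ Lie Hg(H¹A)` for `A` of Ribet type `(g − 1, 1)`**: `dim A = g ≥ 3`, `dim_ℚ End⁰A = 2`, `φ ∘ φ = −d` with multiplicity one at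
`i√d` or `−i√d`.  `Lie Hg(H¹A) = 𝔲_K(H¹A, ψ)` = the `ψ`-skew operators commuting with `φ^*` (`UnitaryTheta.mem_hodgeLie_iff_commute_and_skew`,
Ribet's `Hg = U`), and `φ^*` itself is `ψ`-skew (the Rosati involution is complex conjugation on `K = ℚ(φ)`:
`UnitaryTheta.form_apply_add_form_apply_eq_zero`). [cite: Ribet1983, Thm. 3] [cite: MoonenZarhin1999LowDim, §2 (2.3)] [cite: MumfordAV1970, §21] -/
theorem bettiMap_mem_hodgeLie_of_ribetTypeOne (hA : IsSmoothProjective n A.X) (φ : A ⟶ A) {d : ℕ} (hd : 0 < d)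
    (hφ : φ ≫ φ = -(d • 𝟙 A)) (hE2 : Module.finrank ℚ A.endAlgebra = 2)
    (h1 : eigenMultiplicity A φ (Complex.I * (Real.sqrt d : ℂ)) = 1 ∨ eigenMultiplicity A φ (-(Complex.I * (Real.sqrt d : ℂ))) = 1)
    (hdim : 3 ≤ A.dim) :
    haveI := BettiUniverse.finite hA 1
    (bettiCohomology.map φ.hom.hom.hom 1).hom ∈ (BettiUniverse.hodge exists_isReal_hodgeModel_holds hA 1).hodgeLie := by
  classical
  have hnA : A.dim = n := schemeDim_eq_holds hA
  subst hnA
  haveI := BettiUniverse.finite hA 1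
  haveI : Nontrivial (bettiCohomology A.X 1) := by
    apply Module.nontrivial_of_finrank_pos (R := ℚ)
    rw [finrank_bettiCohomology_one A]
    omega
  obtain ⟨ψ⟩ := BettiUniverse.hodge_isPolarizable exists_isReal_hodgeModel_holds hA 1
  have heff := BettiUniverse.hodge_isEffective exists_isReal_hodgeModel_holds hA 1
  set φQ : Module.End ℚ (bettiCohomology A.X 1) := (bettiCohomology.map φ.hom.hom.hom 1).hom with hφQ
  have hφE : φQ ∈ (BettiUniverse.hodge exists_isReal_hodgeModel_holds hA 1).endAlg :=
    pullback_mem_endAlg exists_isReal_hodgeModel_holds hodgePQ_independent_of_hodgeModel_holds φ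
  have hφ2 : φQ * φQ = -((d : ℚ) • 1) := bettiMapHom_mul_self hφ
  have hdQ : (0 : ℚ) < d := Nat.cast_pos.2 hd
  have hE := exists_eq_smul_one_add_smul_bettiMapHom exists_isReal_hodgeModel_holds hodgePQ_independent_of_hodgeModel_holds hd hφ hE2
    (by omega)
  have hsum := eigenMultiplicity_add_eigenMultiplicity_neg_eq_dim A φ hd hφ
  have hμ₀ : (Complex.I * (Real.sqrt d : ℂ)) ^ 2 = -((d : ℚ) : ℂ) := by
    rw [mul_pow, Complex.I_sq, ← Complex.ofReal_pow, Real.sq_sqrt (Nat.cast_nonneg d), Complex.ofReal_natCast,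
      Rat.cast_natCast, neg_one_mul]
  have hconj₀ : starRingEnd ℂ (Complex.I * (Real.sqrt d : ℂ)) = -(Complex.I * (Real.sqrt d : ℂ)) := by
    rw [map_mul, Complex.conj_I, Complex.conj_ofReal, neg_mul]
  obtain ⟨μ, hμ, hm1, hm2⟩ : ∃ μ : ℂ, μ ^ 2 = -((d : ℚ) : ℂ) ∧
      eigenMultiplicity A φ (starRingEnd ℂ μ) = 1 ∧ 2 ≤ eigenMultiplicity A φ μ := by
    rcases h1 with h | h
    · exact ⟨-(Complex.I * (Real.sqrt d : ℂ)), by rw [neg_sq, hμ₀], by rw [map_neg, hconj₀, neg_neg, h], by omega⟩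
    · exact ⟨Complex.I * (Real.sqrt d : ℂ), hμ₀, by rw [hconj₀, h], by omega⟩
  have h1' : Module.finrank ℂ ↥(Module.End.eigenspace (φQ.baseChange ℂ) μ ⊓
      (BettiUniverse.hodge exists_isReal_hodgeModel_holds hA 1).piece 0 1) = 1 := by
    rw [hφQ, finrank_eigenspace_inf_piece_zeroOne_eq_eigenMultiplicity_conj exists_isReal_hodgeModel_holds
      hodgePQ_independent_of_hodgeModel_holds φ μ, hm1]
  have h2' : 2 ≤ Module.finrank ℂ ↥(Module.End.eigenspace (φQ.baseChange ℂ) μ ⊓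
      (BettiUniverse.hodge exists_isReal_hodgeModel_holds hA 1).piece 1 0) := by
    rw [hφQ, finrank_eigenspace_inf_piece_oneZero_eq_eigenMultiplicity exists_isReal_hodgeModel_holds
      hodgePQ_independent_of_hodgeModel_holds φ μ]
    exact hm2
  rw [UnitaryTheta.mem_hodgeLie_iff_commute_and_skew _ Nat.cast_one heff ψ hφE hdQ hφ2 hE hμ h1' h2']
  exact ⟨rfl, UnitaryTheta.form_apply_add_form_apply_eq_zero _ ψ hφE hdQ hφ2 hE⟩

omit [HodgeTensorFacts.{0, 0}] in
/-- `φ^* ∈ Lie Hg(H¹T)` for a simple abelian threefold `T` with `dim_ℚ End⁰T = 2` and any `φ ∘ φ = −d`, `d > 0` (both multiplicities are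
positive — `T` simple — and sum to `3`, so one of them is `1`). [cite: MoonenZarhin1999LowDim, §2 (2.3)] [cite: Ribet1983, Thm. 3] -/
theorem bettiMap_mem_hodgeLie_of_isSimple_threefold [HodgeTensorFacts.{0, 0}] (hT : IsSmoothProjective n A.X) (hTs : A.IsSimple)
    (hT3 : A.dim = 3) (hTE : Module.finrank ℚ A.endAlgebra = 2) (φ : A ⟶ A) {d : ℕ} (hd : 0 < d) (hφ : φ ≫ φ = -(d • 𝟙 A)) :
    haveI := BettiUniverse.finite hT 1
    (bettiCohomology.map φ.hom.hom.hom 1).hom ∈ (BettiUniverse.hodge exists_isReal_hodgeModel_holds hT 1).hodgeLie := by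
  have hsum := eigenMultiplicity_add_eigenMultiplicity_neg_eq_dim A φ hd hφ
  have hpos := AbelianVariety.eigenMultiplicity_pos_of_isSimple A hTs φ hd hφ (by omega)
  exact bettiMap_mem_hodgeLie_of_ribetTypeOne hT φ hd hφ hTE (by omega) (by omega)

omit [HodgeTensorFacts.{0, 0}] in
/-- A simple abelian threefold with `dim_ℚ End⁰T = 2` and `φ ∘ φ = −d` is of Ribet type `(2,1)`: `End⁰T` is a (non-totally-real) field and one of
the two multiplicities is `1` (Shimura: `[F:ℚ] ∣ dim` for totally real `F`, `2 ∤ 3`; `T` simple ⟹ both multiplicities positive, sum `3`).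
[cite: MoonenZarhin1999LowDim, §2 (2.3)] [cite: Ribet1983, Thm. 3] -/
theorem ribetTypeOne_data_of_isSimple_threefold (hTs : A.IsSimple) (hT3 : A.dim = 3) (hTE : Module.finrank ℚ A.endAlgebra = 2) (φ : A ⟶ A)
    {d : ℕ} (hd : 0 < d) (hφ : φ ≫ φ = -(d • 𝟙 A)) :
    ∃ hF : IsField A.endAlgebra, ¬ IsTotallyReal (EndField A hF) ∧
      (eigenMultiplicity A φ (Complex.I * (Real.sqrt d : ℂ)) = 1 ∨ eigenMultiplicity A φ (-(Complex.I * (Real.sqrt d : ℂ))) = 1) := by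
  have h0 : 0 < A.dim := by omega
  have hF : IsField A.endAlgebra := AbelianVariety.isField_endAlgebra_of_isSimple_of_finrank_eq_two hTs h0 hTE
  have hnR : ¬ IsTotallyReal (EndField A hF) := fun hR => by
    have h := finrank_endAlgebra_dvd_dim_of_isField_of_isTotallyReal hF h0 hR
    rw [hTE, hT3] at h
    omega
  have hsum := eigenMultiplicity_add_eigenMultiplicity_neg_eq_dim A φ hd hφ
  have hpos := AbelianVariety.eigenMultiplicity_pos_of_isSimple A hTs φ hd hφ (by omega)
  exact ⟨hF, hnR, by omega⟩

omit [HodgeTensorFacts.{0, 0}] in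
/-- The multiplicity flips under `φ ↦ −φ` (`(−φ)^* = −φ^*`, `complexBetti_map_neg_one`; cf. ring2's `Ring2.Atlas.eigenMultiplicity_neg`).
[cite: LangeBirkenhake1992, §1.1 (p. 19)] -/
private theorem eigenMultiplicity_neg'' (φ : A ⟶ A) (μ : ℂ) : eigenMultiplicity A (-φ) μ = eigenMultiplicity A φ (-μ) := by
  have hE : Module.End.eigenspace (complexBetti.map (-φ).hom.hom.hom 1).hom μ =
      Module.End.eigenspace (complexBetti.map φ.hom.hom.hom 1).hom (-μ) := by
    rw [complexBetti_map_neg_one]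
    ext x
    rw [Module.End.mem_eigenspace_iff, Module.End.mem_eigenspace_iff, ModuleCat.hom_neg, LinearMap.neg_apply, neg_smul]
    exact neg_eq_iff_eq_neg
  unfold eigenMultiplicity
  rw [hE]

omit [HodgeTensorFacts.{0, 0}] in
/-- **MATCHED DATA FROM A RING HOM `End⁰T' → End⁰T`** for two simple abelian threefolds: `φ ∘ φ = −D` on `T`, `φ' ∘ φ' = −D` on `T'` with
`n_{i√D}(T) + n_{i√D}(T') = 3` (total Weil signature `(3,3)`).  Construction: `φ'₀ ∘ φ'₀ = −d'` on `T'` (type IV(1,1), Shimura); `f(φ'₀) = M⁻¹ ⊗ F`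
in `End⁰T` (Mumford §19 Thm. 3), `φ := F`, `φ' := M φ'₀`, `D := M² d'`; both pairs of multiplicities are `{1,2}` (`T`, `T'` simple), replace
`φ'` by `−φ'` if the sum is `2` or `4`. [cite: MumfordAV1970, §19 Thm. 3 and Cor. 2] [cite: MoonenZarhin1999LowDim, §2 (2.3)] -/
theorem exists_matched_data_of_ringHom_threefolds {T T' : AbelianVariety ℂ} (hTs : T.IsSimple) (hT3 : T.dim = 3) (hT's : T'.IsSimple)
    (hT'3 : T'.dim = 3) (hT'E : Module.finrank ℚ T'.endAlgebra = 2) (f : T'.endAlgebra →+* T.endAlgebra) :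
    ∃ (φ : T ⟶ T) (φ' : T' ⟶ T') (D : ℕ), 0 < D ∧ φ ≫ φ = -(D • 𝟙 T) ∧ φ' ≫ φ' = -(D • 𝟙 T') ∧
      eigenMultiplicity T φ (Complex.I * (Real.sqrt D : ℂ)) + eigenMultiplicity T' φ' (Complex.I * (Real.sqrt D : ℂ)) = 3 := by
  obtain ⟨χ₀, d', hd', hχ₀⟩ := exists_hom_comp_self_eq_neg_of_isSimple_threefold_of_finrank_eq_two hT's hT'3 hT'E
  have ha : f (AbelianVariety.endAlgebra.of T' χ₀) * f (AbelianVariety.endAlgebra.of T' χ₀) = -((d' : ℚ) • 1) := by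
    rw [← map_mul, endAlgebra_of_mul_self_eq_neg hχ₀, map_neg, Nat.cast_smul_eq_nsmul, Nat.cast_smul_eq_nsmul, map_nsmul, map_one]
  obtain ⟨M, F, hM, hMF⟩ := AbelianVariety.endAlgebra.exists_eq_algebraMap_mul_of (f (AbelianVariety.endAlgebra.of T' χ₀))
  have hMQ : (M : ℚ) ≠ 0 := Nat.cast_ne_zero.2 hM
  have hF : AbelianVariety.endAlgebra.of T F = (M : ℚ) • f (AbelianVariety.endAlgebra.of T' χ₀) := by
    rw [hMF, Algebra.algebraMap_eq_smul_one, smul_mul_assoc, one_mul, smul_smul, mul_inv_cancel₀ hMQ, one_smul]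
  have hFF : F * F = -((M * M * d') • 1) := by
    apply AbelianVariety.endAlgebra.of_injective_of_charZero (A := T)
    rw [map_mul, hF, smul_mul_smul_comm, ha, smul_neg, smul_smul, map_neg, map_nsmul, map_one,
      ← Nat.cast_smul_eq_nsmul ℚ (M * M * d') (1 : T.endAlgebra), Nat.cast_mul, Nat.cast_mul]
  have hφ : (F : T ⟶ T) ≫ F = -((M * M * d') • 𝟙 T) := hFF
  have hχ : (M • χ₀) ≫ (M • χ₀) = -((M * M * d') • 𝟙 T') := by
    rw [Preadditive.nsmul_comp, Preadditive.comp_nsmul, hχ₀, smul_neg, smul_neg, smul_smul, smul_smul]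
  have hD : 0 < M * M * d' := Nat.mul_pos (Nat.mul_pos (Nat.pos_of_ne_zero hM) (Nat.pos_of_ne_zero hM)) hd'
  have hsumT := eigenMultiplicity_add_eigenMultiplicity_neg_eq_dim T F hD hφ
  have hsumT' := eigenMultiplicity_add_eigenMultiplicity_neg_eq_dim T' (M • χ₀) hD hχ
  have hposT := AbelianVariety.eigenMultiplicity_pos_of_isSimple T hTs F hD hφ (by omega)
  have hposT' := AbelianVariety.eigenMultiplicity_pos_of_isSimple T' hT's (M • χ₀) hD hχ (by omega)
  rw [hT3] at hsumT
  rw [hT'3] at hsumT'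
  by_cases h3 : eigenMultiplicity T F (Complex.I * (Real.sqrt (M * M * d' : ℕ) : ℂ)) +
      eigenMultiplicity T' (M • χ₀) (Complex.I * (Real.sqrt (M * M * d' : ℕ) : ℂ)) = 3
  · exact ⟨F, M • χ₀, M * M * d', hD, hφ, hχ, h3⟩
  · refine ⟨F, -(M • χ₀), M * M * d', hD, hφ, ?_, ?_⟩
    · rw [Preadditive.neg_comp, Preadditive.comp_neg, neg_neg, hχ]
    · rw [eigenMultiplicity_neg'']
      omega

end RibetType

/-! ## §2 Two Ribet-type `(g−1,1)` abelian varieties of the same dimension and field: `dim Lie Hg(H¹(A × A')) < 2g²` -/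

variable [HodgeTensorFacts.{0, 0}] {X : AbelianVariety ℂ} {n : ℕ}

/-- **`dim Lie Hg(H¹(A × A')) < g² + g²` for two abelian varieties of Ribet type `(g−1,1)` of the same dimension `g ≥ 3` with the same field and
matched roots** (`φ ∘ φ = −D` on `A`, `φ' ∘ φ' = −D` on `A'`, `End⁰` non-totally-real quadratic fields, multiplicity one at `± i√D`,
`n_{i√D}(A) + n_{i√D}(A') = g`).  The diagonal action of `k = End⁰A'` on `H¹(A × A')` (`φ' ↦ φ` on the first factor) is of Weil type `(g,g)`, so the
corner `0 ⊕ φ'^*` — with `φ'^* ∈ Lie Hg(H¹A')` — is not in `Lie Hg(H¹(A × A'))` (`corner_not_mem_and_finrank_hodgeLie_lt_of_weilType_of_two_le`), and `dim Lie Hg(H¹A) =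
dim Lie Hg(H¹A') = g²` (Ribet). [cite: MoonenZarhin1999LowDim, Thm. 0.1 (4) and §3 (3.1)] [cite: Ribet1983, Thm. 3] [cite: Deligne1982HodgeCycles, §4 Prop. 4.4] -/
theorem finrank_hodgeLie_hodge_one_prod_ribetTypeOne_lt {A A' : AbelianVariety ℂ} {m : ℕ} (hP : IsSmoothProjective m (A.prod A').X)
    (hF : IsField A.endAlgebra) (hnR : ¬ IsTotallyReal (EndField A hF)) (φ : A ⟶ A) {D : ℕ} (hD : 0 < D) (hφ : φ ≫ φ = -(D • 𝟙 A))
    (hAE : Module.finrank ℚ A.endAlgebra = 2)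
    (h1 : eigenMultiplicity A φ (Complex.I * (Real.sqrt D : ℂ)) = 1 ∨ eigenMultiplicity A φ (-(Complex.I * (Real.sqrt D : ℂ))) = 1)
    (hF' : IsField A'.endAlgebra) (hnR' : ¬ IsTotallyReal (EndField A' hF')) (φ' : A' ⟶ A') (hφ' : φ' ≫ φ' = -(D • 𝟙 A'))
    (hA'E : Module.finrank ℚ A'.endAlgebra = 2)
    (h1' : eigenMultiplicity A' φ' (Complex.I * (Real.sqrt D : ℂ)) = 1 ∨ eigenMultiplicity A' φ' (-(Complex.I * (Real.sqrt D : ℂ))) = 1)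
    (hdim : 3 ≤ A.dim) (hdd : A'.dim = A.dim)
    (hmult : eigenMultiplicity A φ (Complex.I * (Real.sqrt D : ℂ)) + eigenMultiplicity A' φ' (Complex.I * (Real.sqrt D : ℂ)) = A.dim) :
    haveI := BettiUniverse.finite hP 1
    Module.finrank ℚ (BettiUniverse.hodge exists_isReal_hodgeModel_holds hP 1).hodgeLie < A.dim * A.dim + A.dim * A.dim := by
  classical
  have hnP : (A.prod A').dim = m := schemeDim_eq_holds hP
  subst hnP
  have hT : IsSmoothProjective A.dim A.X := AbelianVariety.isSmoothProjective_holds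
  have hT' : IsSmoothProjective A'.dim A'.X := AbelianVariety.isSmoothProjective_holds
  haveI := BettiUniverse.finite hP 1
  haveI := BettiUniverse.finite hT 1
  haveI := BettiUniverse.finite hT' 1
  have h9 : Module.finrank ℚ (BettiUniverse.hodge exists_isReal_hodgeModel_holds hT 1).hodgeLie = A.dim * A.dim :=
    (mtRank_hodge_one_of_ribetTypeOne' hT hF hnR φ hD hφ hAE h1 hdim).2
  have h9' : Module.finrank ℚ (BettiUniverse.hodge exists_isReal_hodgeModel_holds hT' 1).hodgeLie = A.dim * A.dim := by
    rw [(mtRank_hodge_one_of_ribetTypeOne' hT' hF' hnR' φ' hD hφ' hA'E h1' (by omega)).2, hdd]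
  -- `k := End⁰A'`, a quadratic field, `c := φ'`
  haveI : Module.Finite ℚ (EndField A' hF') := NumberField.to_finiteDimensional
  have hK2 : Module.finrank ℚ (EndField A' hF') = 2 := by rw [EndField.finrank_eq, hA'E]
  let ρ' : EndField A' hF' →+* A'.endAlgebra := (EndField.toEndAlgebra hF').toRingHom
  let c : EndField A' hF' := (EndField.toEndAlgebra hF').symm (AbelianVariety.endAlgebra.of A' φ')
  have hρ'c : ρ' c = AbelianVariety.endAlgebra.of A' φ' := (EndField.toEndAlgebra hF').apply_symm_apply _
  have hcK : c * c = -((D : ℚ) • (1 : EndField A' hF')) := by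
    apply (EndField.toEndAlgebra hF').injective
    rw [map_mul, (EndField.toEndAlgebra hF').apply_symm_apply, endAlgebra_of_mul_self_eq_neg hφ', map_neg, Nat.cast_smul_eq_nsmul,
      Nat.cast_smul_eq_nsmul, map_nsmul, map_one]
  have hc0 : c ≠ 0 := by
    intro h
    rw [h, mul_zero, eq_comm, neg_eq_zero, smul_eq_zero] at hcK
    rcases hcK with h' | h'
    · exact hD.ne' (by exact_mod_cast h')
    · exact one_ne_zero h'
  -- `k → End⁰A`, `c ↦ φ`
  obtain ⟨ρT, hρTc⟩ := exists_ringHom_apply_eq_of_sq_eq_neg hK2 (Nat.cast_pos.2 hD) hcK (R := A.endAlgebra)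
    (b := AbelianVariety.endAlgebra.of A φ) (endAlgebra_of_mul_self_eq_neg hφ)
  let A₁ : EndAction (BettiUniverse.hodge exists_isReal_hodgeModel_holds hT 1) (EndField A' hF') :=
    hOneEndAction ρT exists_isReal_hodgeModel_holds hodgePQ_independent_of_hodgeModel_holds
  let A₂ : EndAction (BettiUniverse.hodge exists_isReal_hodgeModel_holds hT' 1) (EndField A' hF') :=
    hOneEndAction ρ' exists_isReal_hodgeModel_holds hodgePQ_independent_of_hodgeModel_holds
  -- the bicone of `H¹(A × A')`
  let ι₁ := BettiUniverse.pullHodgeHom exists_isReal_hodgeModel_holds hodgePQ_independent_of_hodgeModel_holds hP hT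
    (fst A A').hom.hom.hom 1
  let π₁ := BettiUniverse.pullHodgeHom exists_isReal_hodgeModel_holds hodgePQ_independent_of_hodgeModel_holds hT hP
    (prodLift (𝟙 A) (0 : A ⟶ A')).hom.hom.hom 1
  let ι₂ := BettiUniverse.pullHodgeHom exists_isReal_hodgeModel_holds hodgePQ_independent_of_hodgeModel_holds hP hT'
    (snd A A').hom.hom.hom 1
  let π₂ := BettiUniverse.pullHodgeHom exists_isReal_hodgeModel_holds hodgePQ_independent_of_hodgeModel_holds hT' hP
    (prodLift (0 : A' ⟶ A) (𝟙 A')).hom.hom.hom 1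
  have hsumP : fst A A' ≫ prodLift (𝟙 A) (0 : A ⟶ A') + snd A A' ≫ prodLift (0 : A' ⟶ A) (𝟙 A') = 𝟙 _ := by
    refine prod_hom_ext ?_ ?_
    · rw [Preadditive.add_comp, Category.assoc, Category.assoc, prodLift_fst, prodLift_fst, Category.comp_id,
        comp_zero, add_zero, Category.id_comp]
    · rw [Preadditive.add_comp, Category.assoc, Category.assoc, prodLift_snd, prodLift_snd, Category.comp_id,
        comp_zero, zero_add, Category.id_comp]
  have hπι₁ : ∀ v, π₁.toLinearMap (ι₁.toLinearMap v) = v := fun v => pull_pull_eq_self_of_comp_eq_id (prodLift_fst _ _) v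
  have hπι₂ : ∀ v, π₂.toLinearMap (ι₂.toLinearMap v) = v := fun v => pull_pull_eq_self_of_comp_eq_id (prodLift_snd _ _) v
  have hsum : ∀ v, ι₁.toLinearMap (π₁.toLinearMap v) + ι₂.toLinearMap (π₂.toLinearMap v) = v := fun v =>
    pull_pull_add_pull_pull_eq_self _ _ _ _ hsumP v
  have h12 : ∀ v, π₁.toLinearMap (ι₂.toLinearMap v) = 0 := fun v => by
    have h := congrArg π₁.toLinearMap (hsum (ι₂.toLinearMap v))
    rw [map_add, hπι₂ v, hπι₁] at h
    exact add_eq_left.1 h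
  have h21 : ∀ v, π₂.toLinearMap (ι₁.toLinearMap v) = 0 := fun v => by
    have h := congrArg π₂.toLinearMap (hsum (ι₁.toLinearMap v))
    rw [map_add, hπι₁ v, hπι₂] at h
    exact add_eq_left.1 h
  -- the diagonal action on `H¹(A × A')`
  let L : EndField A' hF' →ₗ[ℚ] Module.End ℚ (bettiCohomology (A.prod A').X 1) :=
    { toFun := fun a => ι₁.toLinearMap ∘ₗ A₁.ι a ∘ₗ π₁.toLinearMap + ι₂.toLinearMap ∘ₗ A₂.ι a ∘ₗ π₂.toLinearMap
      map_add' := fun a b => by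
        rw [map_add, map_add, LinearMap.add_comp, LinearMap.comp_add, LinearMap.add_comp, LinearMap.comp_add]; abel
      map_smul' := fun q a => by
        rw [map_smul, map_smul, LinearMap.smul_comp, LinearMap.comp_smul, LinearMap.smul_comp, LinearMap.comp_smul, RingHom.id_apply,
          smul_add] }
  have hL : ∀ a, L a = ι₁.toLinearMap ∘ₗ A₁.ι a ∘ₗ π₁.toLinearMap + ι₂.toLinearMap ∘ₗ A₂.ι a ∘ₗ π₂.toLinearMap := fun a => rfl
  have hL1 : L 1 = 1 := by
    rw [hL, map_one, map_one]
    refine LinearMap.ext fun v => ?_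
    rw [LinearMap.add_apply, LinearMap.comp_apply, LinearMap.comp_apply, LinearMap.comp_apply, LinearMap.comp_apply,
      Module.End.one_apply, Module.End.one_apply, Module.End.one_apply, hsum]
  have hLmul : ∀ a b, L (a * b) = L a * L b := by
    intro a b
    rw [hL, hL, hL, map_mul, map_mul]
    refine LinearMap.ext fun v => ?_
    simp only [LinearMap.add_apply, LinearMap.comp_apply, Module.End.mul_apply, map_add, hπι₁, hπι₂, h12, h21, map_zero,
      add_zero, zero_add]
  have hLmem : ∀ a, L a ∈ (BettiUniverse.hodge exists_isReal_hodgeModel_holds hP 1).endAlg := fun a =>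
    Subalgebra.add_mem _ (((ι₁.comp (endAlg.toHom ⟨A₁.ι a, fun p => A₁.map_F_le a p⟩)).comp π₁).toLinearMap_mem_endAlg)
      (((ι₂.comp (endAlg.toHom ⟨A₂.ι a, fun p => A₂.map_F_le a p⟩)).comp π₂).toLinearMap_mem_endAlg)
  let Ad : EndAction (BettiUniverse.hodge exists_isReal_hodgeModel_holds hP 1) (EndField A' hF') :=
    { ι := AlgHom.ofLinearMap L hL1 hLmul, map_F_le := fun a p => hLmem a p }
  have hAι : ∀ a, Ad.ι a = L a := fun a => rfl
  have hA₁ : ∀ a, Ad.ι a ∘ₗ ι₁.toLinearMap = ι₁.toLinearMap ∘ₗ A₁.ι a := fun a => by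
    rw [hAι, hL]
    refine LinearMap.ext fun v => ?_
    simp only [LinearMap.add_apply, LinearMap.comp_apply, hπι₁, h21, map_zero, add_zero]
  have hA₂ : ∀ a, Ad.ι a ∘ₗ ι₂.toLinearMap = ι₂.toLinearMap ∘ₗ A₂.ι a := fun a => by
    rw [hAι, hL]
    refine LinearMap.ext fun v => ?_
    simp only [LinearMap.add_apply, LinearMap.comp_apply, hπι₂, h12, map_zero, zero_add]
  -- Weil type `(g,g)`: `2 (n_σ(A) + n_σ(A')) = 2g = 4g / 2`
  have hsumT := eigenMultiplicity_add_eigenMultiplicity_neg_eq_dim A φ hD hφ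
  have hsumT' := eigenMultiplicity_add_eigenMultiplicity_neg_eq_dim A' φ' hD hφ'
  rw [hdd] at hsumT'
  have hV : Module.finrank ℚ (bettiCohomology (A.prod A').X 1) = 2 * (2 * A.dim) := by rw [finrank_bettiCohomology_one, dim_prod, hdd]; ring
  have hW : ∀ σ : EndField A' hF' →+* ℂ, 2 * (A₁.multiplicity σ + A₂.multiplicity σ) =
      Module.finrank ℚ (bettiCohomology (A.prod A').X 1) / 2 := by
    intro σ
    rw [hV, Nat.mul_div_cancel_left _ two_pos, multiplicity_hOneEndAction_eq_eigenMultiplicity ρT hK2 hD hcK φ hρTc σ,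
      multiplicity_hOneEndAction_eq_eigenMultiplicity ρ' hK2 hD hcK φ' hρ'c σ]
    rcases apply_eq_or_eq_neg_of_sq_eq_neg hcK σ with h | h <;> rw [h] <;> omega
  have hV₂ : 2 ≤ Module.finrank ℚ (bettiCohomology A'.X 1) := by rw [finrank_bettiCohomology_one, hdd]; omega
  have heff := BettiUniverse.hodge_isEffective exists_isReal_hodgeModel_holds hP 1
  -- `φ'^* ∈ Lie Hg(H¹A')`
  have hmem : A₂.ι c ∈ (BettiUniverse.hodge exists_isReal_hodgeModel_holds hT' 1).hodgeLie := by
    have hA₂c : A₂.ι c = (bettiCohomology.map φ'.hom.hom.hom 1).hom := by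
      change hOneAlgHom ρ' c = _
      rw [hOneAlgHom_apply, hρ'c, bettiRep_of, MulOpposite.unop_op]
    rw [hA₂c]
    exact bettiMap_mem_hodgeLie_of_ribetTypeOne hT' φ' hD hφ' hA'E h1' (by omega)
  have hlt := (corner_not_mem_and_finrank_hodgeLie_lt_of_weilType_of_two_le ι₁ π₁ ι₂ π₂ hπι₁ hπι₂ hsum A₁ A₂ Ad hA₁ hA₂ heff hK2 hV₂
    hW hc0).2 hmem
  rw [h9, h9'] at hlt
  exact hlt

/-- **`g² + 1 ≤ t(X) ≤ 2g²` for `X ∼ A × A'`, `A`, `A'` of Ribet type `(g−1,1)` of the same dimension with `φ ∘ φ = −D = φ' ∘ φ'`** (isomorphic fields;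
NO root matching assumed — one of `± φ'` matches, since both multiplicities lie in `{1, g−1}`), strictly below `t(A) + t(A') − 1 = 2g² + 1`:
`Hg(A × A') ≠ Hg(A) × Hg(A')`.  Lower bound: `A` is `Θ`-rigid (`CorCM/MumfordTateRankRigidMonotone`).
[cite: MoonenZarhin1999LowDim, Thm. 0.1 (4) and §3 (3.1)] [cite: Ribet1983, Thm. 3] -/
theorem mtRank_hodge_one_mem_Icc_of_isIsogenous_prod_ribetTypeOne_of_comp_self_eq_neg (hX : IsSmoothProjective n X.X) {A A' : AbelianVariety ℂ}
    (hF : IsField A.endAlgebra) (hnR : ¬ IsTotallyReal (EndField A hF)) (φ : A ⟶ A) {D : ℕ} (hD : 0 < D) (hφ : φ ≫ φ = -(D • 𝟙 A))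
    (hAE : Module.finrank ℚ A.endAlgebra = 2)
    (h1 : eigenMultiplicity A φ (Complex.I * (Real.sqrt D : ℂ)) = 1 ∨ eigenMultiplicity A φ (-(Complex.I * (Real.sqrt D : ℂ))) = 1)
    (hF' : IsField A'.endAlgebra) (hnR' : ¬ IsTotallyReal (EndField A' hF')) (φ' : A' ⟶ A') (hφ' : φ' ≫ φ' = -(D • 𝟙 A'))
    (hA'E : Module.finrank ℚ A'.endAlgebra = 2)
    (h1' : eigenMultiplicity A' φ' (Complex.I * (Real.sqrt D : ℂ)) = 1 ∨ eigenMultiplicity A' φ' (-(Complex.I * (Real.sqrt D : ℂ))) = 1)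
    (hdim : 3 ≤ A.dim) (hdd : A'.dim = A.dim) (hXP : IsIsogenous X (A.prod A')) :
    haveI := BettiUniverse.finite hX 1
    (BettiUniverse.hodge exists_isReal_hodgeModel_holds hX 1).mtRank ∈ Set.Icc (A.dim * A.dim + 1) (2 * (A.dim * A.dim)) := by
  haveI := BettiUniverse.finite hX 1
  have hT : IsSmoothProjective A.dim A.X := AbelianVariety.isSmoothProjective_holds
  haveI := BettiUniverse.finite hT 1
  have hP : IsSmoothProjective (A.prod A').dim (A.prod A').X := AbelianVariety.isSmoothProjective_holds
  haveI := BettiUniverse.finite hP 1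
  have h0 : 0 < X.dim := by
    obtain ⟨g, hg⟩ := hXP
    rw [dim_eq_of_isIsogeny hg, dim_prod]; omega
  constructor
  · have hle := mtRank_hodge_one_le_of_isIsogenous_prod_of_rigid hX hT (by omega) (hodgeLie_rigid_of_ribetTypeOne hT φ hD hφ hAE h1 hdim) hXP
    have hgg := (mtRank_hodge_one_of_ribetTypeOne' hT hF hnR φ hD hφ hAE h1 hdim).1
    rw [hgg] at hle
    exact hle
  · -- match the roots with `φ'` or `−φ'`
    have hsum := eigenMultiplicity_add_eigenMultiplicity_neg_eq_dim A φ hD hφ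
    have hsum' := eigenMultiplicity_add_eigenMultiplicity_neg_eq_dim A' φ' hD hφ'
    rw [hdd] at hsum'
    have hiso := finrank_hodgeLie_hodge_one_eq_of_isIsogenous hX hP hXP
    rw [mtRank_hodge_one_eq_finrank_hodgeLie_add_one hX h0, hiso]
    by_cases hm : eigenMultiplicity A φ (Complex.I * (Real.sqrt D : ℂ)) + eigenMultiplicity A' φ' (Complex.I * (Real.sqrt D : ℂ)) = A.dim
    · have h := finrank_hodgeLie_hodge_one_prod_ribetTypeOne_lt hP hF hnR φ hD hφ hAE h1 hF' hnR' φ' hφ' hA'E h1' hdim hdd hm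
      omega
    · have hφ'' : (-φ') ≫ (-φ') = -(D • 𝟙 A') := by rw [Preadditive.neg_comp, Preadditive.comp_neg, neg_neg, hφ']
      have h1'' : eigenMultiplicity A' (-φ') (Complex.I * (Real.sqrt D : ℂ)) = 1 ∨
          eigenMultiplicity A' (-φ') (-(Complex.I * (Real.sqrt D : ℂ))) = 1 := by
        rw [eigenMultiplicity_neg'', eigenMultiplicity_neg'', neg_neg]; exact h1'.symm
      have hm' : eigenMultiplicity A φ (Complex.I * (Real.sqrt D : ℂ)) + eigenMultiplicity A' (-φ') (Complex.I * (Real.sqrt D : ℂ)) = A.dim := by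
        rw [eigenMultiplicity_neg'']
        rcases h1 with h | h <;> rcases h1' with h' | h' <;> omega
      have h := finrank_hodgeLie_hodge_one_prod_ribetTypeOne_lt hP hF hnR φ hD hφ hAE h1 hF' hnR' (-φ') hφ'' hA'E h1'' hdim hdd hm'
      omega

end Summit.HodgeConjecture.CorCM

end
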